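import Mathlib
import Literature.NumberTheory.Transcendental.KZCalculus

/-!
# `PentagonInKZ`, line `edge-normal-newton-leibniz`: corner engine — calculus of the dilated cubical word integrands (vertical side)

Stub `cornerEngine_calcV` of the crux `PentagonInKZ` (stmt-KontsevichZagierPeriods-11348, route
FurushoPentagon), engine lemma of the line `edge-normal-newton-leibniz`.  Pure one-variable real
calculus on the explicit rational functions of the lead's corner engine; no KZ objects occur.

The engine works with the DILATED CUBICAL word integrands of the vertical side: for letters
`k : Fin (m + 2)` with bilinear divisors `φ_k(x, s) = c₀ + c₁ x + c₂ s + c₃ x s` (`cᵢ = cf k i`,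
`φ₀ = x`, `φ₁ = s`) the vertical letter density is `gd k x s = ∂ₛ log φ_k = (c₂ + c₃ x) / φ_k(x, s)`,
and for a word `v : Fin n → Fin (m + 2)` and cubical coordinates `y : Fin n → ℝ`
`qV v y ξ η = ∏ᵢ [v i = 1 ? 1 / yᵢ : (η y₀ ⋯ y_{i-1}) · gd (v i) ξ (η y₀ ⋯ yᵢ)]`,
with the explicit Leibniz-rule `η`-derivative `dqV`.  All three are passed as hypothesised
dictionaries (`hgd`, `hqV`, `hdqV`); the auxiliary lemmas of this file take the same dictionaries
as section hypotheses, so that no definition is introduced.  The theorem `cornerEngine_calcV`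
proves the four clauses the engine consumes:
1. FACTORISATION at the outermost variable `y = Fin.cons y₀ y'`
   (`Fin.prod_univ_succ` and the splitting of the partial products `∏_{j<i}`, `∏_{j≤i}`);
2. `HasDerivAt` in `η` with derivative `dqV` on the box `y ∈ [0,1]ⁿ`, `ξ ∈ [0, α]`, `η ∈ [0, β]`
   (product rule; each factor is `(s P) · gd k ξ (s Q)` with `∂ₛ gd = -gd²`, the divisor being
   nonzero on the box by `hreg` for `k ∉ {0, 1}`, while `gd 0 ≡ 0` by `h0` and the letter `1`
   only occurs in the constant branch `1 / yᵢ`);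
3. the EULER identity `∂ₜ [t · qV v (cons t y') ξ η] = η · dqV v (cons y₀ y') ξ η` at
   `t = y₀ ∈ (0, 1)`: both sides are derivatives of the single smooth function
   `r ↦ qV v (cons 1 y') ξ r` through the homogeneity
   `t · qV v (cons t y') ξ s = qV v (cons 1 y') ξ (s t)` (`t ≠ 0`), by the chain rule and
   uniqueness of derivatives;
4. CONTINUITY of `t ↦ t · qV v (cons t y') ξ η` on `[0, 1]` when the last letter is not `1`:
   by homogeneity the function is `t ↦ qV v (cons 1 y') ξ (η t)` (also at `t = 0`, where both
   vanish), which is differentiable at every point of `[0, 1]` by clause 2.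

References: M. Kontsevich, D. Zagier, *Periods* (2001), §1.2 (rule (3): Newton–Leibniz along
algebraic families — here the elementary calculus feeding it).
-/

noncomputable section

open Finset

namespace Summit.KontsevichZagierPeriods.FurushoPentagon.PentagonInKZ

namespace CornerEngineCalcV

/-! ### Partial products of cubical coordinates along `Fin.cons` -/

section PartialProducts

variable {n : ℕ}

/-- The partial product `∏_{j<0}` is empty. [folklore] -/
theorem prod_lt_zero (y : Fin (n + 1) → ℝ) :
    ∏ j ∈ univ.filter (fun j => j < (0 : Fin (n + 1))), y j = 1 := by
  refine Finset.prod_eq_one fun j hj => ?_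
  simp at hj

/-- The partial product `∏_{j≤0}` is the outermost coordinate. [folklore] -/
theorem prod_le_zero (y : Fin (n + 1) → ℝ) :
    ∏ j ∈ univ.filter (fun j => j ≤ (0 : Fin (n + 1))), y j = y 0 := by
  have h : univ.filter (fun j : Fin (n + 1) => j ≤ 0) = {0} := by
    ext j
    simp
  rw [h, Finset.prod_singleton]

/-- `∏_{j < i+1}` along `Fin.cons`: the outermost coordinate splits off. [folklore] -/
theorem prod_lt_cons_succ (y₀ : ℝ) (y' : Fin n → ℝ) (i : Fin n) :
    ∏ j ∈ univ.filter (fun j => j < i.succ), (Fin.cons y₀ y' : Fin (n + 1) → ℝ) j =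
      y₀ * ∏ j ∈ univ.filter (fun j => j < i), y' j := by
  simp only [Finset.prod_filter, Fin.prod_univ_succ, Fin.cons_zero, Fin.cons_succ,
    Fin.succ_lt_succ_iff, Fin.succ_pos, if_true]

/-- `∏_{j ≤ i+1}` along `Fin.cons`: the outermost coordinate splits off. [folklore] -/
theorem prod_le_cons_succ (y₀ : ℝ) (y' : Fin n → ℝ) (i : Fin n) :
    ∏ j ∈ univ.filter (fun j => j ≤ i.succ), (Fin.cons y₀ y' : Fin (n + 1) → ℝ) j =
      y₀ * ∏ j ∈ univ.filter (fun j => j ≤ i), y' j := by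
  simp only [Finset.prod_filter, Fin.prod_univ_succ, Fin.cons_zero, Fin.cons_succ,
    Fin.succ_le_succ_iff, Fin.zero_le, if_true]

/-- On the unit cube the partial products lie in `[0, 1]`. [folklore] -/
theorem prod_le_mem {y : Fin n → ℝ} (hy : ∀ i, 0 ≤ y i ∧ y i ≤ 1) (i : Fin n) :
    0 ≤ ∏ j ∈ univ.filter (fun j => j ≤ i), y j ∧ ∏ j ∈ univ.filter (fun j => j ≤ i), y j ≤ 1 :=
  ⟨Finset.prod_nonneg fun j _ => (hy j).1,
    Finset.prod_le_one (fun j _ => (hy j).1) fun j _ => (hy j).2⟩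

/-- `Fin.cons` of a point of `[0, 1]` and a point of the unit cube lies in the unit cube.
[folklore] -/
theorem cons_mem {y₀ : ℝ} (h₀ : 0 ≤ y₀ ∧ y₀ ≤ 1) {y' : Fin n → ℝ}
    (hy : ∀ i, 0 ≤ y' i ∧ y' i ≤ 1) (i : Fin (n + 1)) :
    0 ≤ (Fin.cons y₀ y' : Fin (n + 1) → ℝ) i ∧ (Fin.cons y₀ y' : Fin (n + 1) → ℝ) i ≤ 1 := by
  cases i using Fin.cases with
  | zero => simpa using h₀
  | succ j => simpa using hy j

end PartialProducts

/-! ### The dictionary as section hypotheses -/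

section Dictionary

variable {m : ℕ} {cf : Fin (m + 2) → Fin 4 → ℚ} {α β : ℚ} {gd : Fin (m + 2) → ℝ → ℝ → ℝ}
  (hgd : ∀ k x s, gd k x s = ((cf k 2 : ℝ) + (cf k 3 : ℝ) * x) /
    ((cf k 0 : ℝ) + (cf k 1 : ℝ) * x + (cf k 2 : ℝ) * s + (cf k 3 : ℝ) * x * s))
  {qV : ∀ {n : ℕ}, (Fin n → Fin (m + 2)) → (Fin n → ℝ) → ℝ → ℝ → ℝ}
  (hqV : ∀ {n : ℕ} (v : Fin n → Fin (m + 2)) (y : Fin n → ℝ) (ξ η : ℝ), qV v y ξ η =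
    ∏ i, if v i = 1 then 1 / y i else (η * ∏ j ∈ Finset.univ.filter (fun j => j < i), y j) *
      gd (v i) ξ (η * ∏ j ∈ Finset.univ.filter (fun j => j ≤ i), y j))
  {dqV : ∀ {n : ℕ}, (Fin n → Fin (m + 2)) → (Fin n → ℝ) → ℝ → ℝ → ℝ}
  (hdqV : ∀ {n : ℕ} (v : Fin n → Fin (m + 2)) (y : Fin n → ℝ) (ξ η : ℝ), dqV v y ξ η =
    ∑ j, (if v j = 1 then 0 else
      (∏ j' ∈ Finset.univ.filter (fun j' => j' < j), y j') *
          gd (v j) ξ (η * ∏ j' ∈ Finset.univ.filter (fun j' => j' ≤ j), y j') -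
        (η * ∏ j' ∈ Finset.univ.filter (fun j' => j' < j), y j') *
          (∏ j' ∈ Finset.univ.filter (fun j' => j' ≤ j), y j') *
          (gd (v j) ξ (η * ∏ j' ∈ Finset.univ.filter (fun j' => j' ≤ j), y j')) ^ 2) *
      ∏ i ∈ Finset.univ.erase j, if v i = 1 then 1 / y i else
        (η * ∏ j' ∈ Finset.univ.filter (fun j' => j' < i), y j') *
          gd (v i) ξ (η * ∏ j' ∈ Finset.univ.filter (fun j' => j' ≤ i), y j'))

include hgd in
/-- `∂ₛ gd k x = -(gd k x)²`: `gd = N / φ` with `∂ₛ φ = N` (trivial when `N = 0`). [folklore] -/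
theorem hasDerivAt_gd (k : Fin (m + 2)) (x r : ℝ)
    (h : (cf k 2 : ℝ) + (cf k 3 : ℝ) * x = 0 ∨
      (cf k 0 : ℝ) + (cf k 1 : ℝ) * x + (cf k 2 : ℝ) * r + (cf k 3 : ℝ) * x * r ≠ 0) :
    HasDerivAt (fun s => gd k x s) (-(gd k x r) ^ 2) r := by
  simp only [hgd]
  rcases h with h | h
  · have e : ∀ s, ((cf k 2 : ℝ) + (cf k 3 : ℝ) * x) /
        ((cf k 0 : ℝ) + (cf k 1 : ℝ) * x + (cf k 2 : ℝ) * s + (cf k 3 : ℝ) * x * s) = 0 := fun s => by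
      rw [h, zero_div]
    refine ((hasDerivAt_const r (0 : ℝ)).congr_of_eventuallyEq
      (Filter.Eventually.of_forall e)).congr_deriv ?_
    rw [e r]
    ring
  · have hd : HasDerivAt
        (fun s => (cf k 0 : ℝ) + (cf k 1 : ℝ) * x + (cf k 2 : ℝ) * s + (cf k 3 : ℝ) * x * s)
        ((cf k 2 : ℝ) + (cf k 3 : ℝ) * x) r := by
      have e : (fun s => (cf k 0 : ℝ) + (cf k 1 : ℝ) * x + (cf k 2 : ℝ) * s + (cf k 3 : ℝ) * x * s) =
          fun s => ((cf k 0 : ℝ) + (cf k 1 : ℝ) * x) + ((cf k 2 : ℝ) + (cf k 3 : ℝ) * x) * s := by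
        funext s
        ring
      rw [e]
      exact (hasDerivAt_const_mul _).const_add _
    refine ((hasDerivAt_const r _).fun_div hd h).congr_deriv ?_
    rw [div_pow]
    ring

include hgd in
/-- Derivative of a non-constant factor `(s P) · gd k ξ (s Q)` of the word integrand. [folklore] -/
theorem hasDerivAt_mul_gd (k : Fin (m + 2)) (ξ P Q η : ℝ)
    (h : (cf k 2 : ℝ) + (cf k 3 : ℝ) * ξ = 0 ∨
      (cf k 0 : ℝ) + (cf k 1 : ℝ) * ξ + (cf k 2 : ℝ) * (η * Q) + (cf k 3 : ℝ) * ξ * (η * Q) ≠ 0) :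
    HasDerivAt (fun s => s * P * gd k ξ (s * Q))
      (P * gd k ξ (η * Q) - η * P * Q * gd k ξ (η * Q) ^ 2) η := by
  have hg := (hasDerivAt_gd hgd k ξ (η * Q) h).comp_of_eq η (hasDerivAt_mul_const Q) rfl
  have hm := (hasDerivAt_mul_const P).mul hg
  have e : (fun s => s * P * gd k ξ (s * Q)) =
      (fun x => x * P) * ((fun s => gd k ξ s) ∘ fun x => x * Q) := by
    funext s
    simp only [Pi.mul_apply, Function.comp_apply]
  rw [e]
  refine hm.congr_deriv ?_
  simp only [Function.comp_apply]
  ring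

include hqV in
/-- FACTORISATION of the word integrand at the outermost variable. [folklore] -/
theorem qV_cons {n : ℕ} (v : Fin (n + 1) → Fin (m + 2)) (y₀ : ℝ) (y' : Fin n → ℝ) (ξ η : ℝ) :
    qV v (Fin.cons y₀ y') ξ η =
      (if v 0 = 1 then 1 / y₀ else η * gd (v 0) ξ (η * y₀)) * qV (Fin.tail v) y' ξ (η * y₀) := by
  rw [hqV, hqV, Fin.prod_univ_succ]
  congr 1
  · simp only [Fin.cons_zero, prod_lt_zero, prod_le_zero, mul_one]
  · refine Finset.prod_congr rfl fun i _ => ?_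
    simp only [Fin.tail, Fin.cons_succ, prod_lt_cons_succ, prod_le_cons_succ, mul_assoc]

include hqV in
/-- HOMOGENEITY: `t · qV v (cons t y') ξ s = qV v (cons 1 y') ξ (s t)` for `t ≠ 0`. [folklore] -/
theorem mul_qV_cons {n : ℕ} (v : Fin (n + 1) → Fin (m + 2)) (t : ℝ) (ht : t ≠ 0)
    (y' : Fin n → ℝ) (ξ s : ℝ) :
    t * qV v (Fin.cons t y') ξ s = qV v (Fin.cons 1 y') ξ (s * t) := by
  simp only [qV_cons hqV, mul_one]
  split_ifs with hv
  · field_simp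
  · ring

include hqV in
/-- The word integrand vanishes at `η = 0` as soon as some letter is not `1`. [folklore] -/
theorem qV_zero {n : ℕ} (v : Fin n → Fin (m + 2)) (y : Fin n → ℝ) (ξ : ℝ) (i : Fin n)
    (hi : v i ≠ 1) : qV v y ξ 0 = 0 := by
  rw [hqV]
  exact Finset.prod_eq_zero (Finset.mem_univ i) (by simp [hi])

include hgd hqV hdqV in
/-- LEIBNIZ RULE: `∂_η qV v y ξ η = dqV v y ξ η` on the box `[0,1]ⁿ × [0,α] × [0,β]`. [folklore] -/
theorem hasDerivAt_qV (h0 : cf 0 = ![0, 1, 0, 0])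
    (hreg : ∀ k : Fin (m + 2), k ≠ 0 → k ≠ 1 → ∀ x y : ℝ, 0 ≤ x → x ≤ (α : ℝ) → 0 ≤ y →
      y ≤ (β : ℝ) → (cf k 0 : ℝ) + (cf k 1 : ℝ) * x + (cf k 2 : ℝ) * y + (cf k 3 : ℝ) * x * y ≠ 0)
    {n : ℕ} (v : Fin n → Fin (m + 2)) (y : Fin n → ℝ) (ξ η : ℝ) (hy : ∀ i, 0 ≤ y i ∧ y i ≤ 1)
    (hξ0 : 0 ≤ ξ) (hξα : ξ ≤ α) (hη0 : 0 ≤ η) (hηβ : η ≤ β) :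
    HasDerivAt (fun s => qV v y ξ s) (dqV v y ξ η) η := by
  simp only [hqV, hdqV]
  have hf : ∀ i ∈ Finset.univ, HasDerivAt
      (fun s => if v i = 1 then 1 / y i else
        (s * ∏ j ∈ univ.filter (fun j => j < i), y j) *
          gd (v i) ξ (s * ∏ j ∈ univ.filter (fun j => j ≤ i), y j))
      (if v i = 1 then 0 else
        (∏ j ∈ univ.filter (fun j => j < i), y j) *
            gd (v i) ξ (η * ∏ j ∈ univ.filter (fun j => j ≤ i), y j) -
          (η * ∏ j ∈ univ.filter (fun j => j < i), y j) *
            (∏ j ∈ univ.filter (fun j => j ≤ i), y j) *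
            gd (v i) ξ (η * ∏ j ∈ univ.filter (fun j => j ≤ i), y j) ^ 2) η := by
    intro i _
    by_cases hv : v i = 1
    · simp only [hv, if_true]
      exact hasDerivAt_const _ _
    · simp only [hv, if_false]
      refine hasDerivAt_mul_gd hgd (v i) ξ _ _ η ?_
      by_cases hz : v i = 0
      · left
        rw [hz, h0]
        simp
      · right
        have hp := prod_le_mem hy i
        exact hreg (v i) hz hv ξ _ hξ0 hξα (mul_nonneg hη0 hp.1)
          ((mul_le_of_le_one_right hη0 hp.2).trans hηβ)
  refine (HasDerivAt.fun_finsetProd hf).congr_deriv ?_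
  simp only [smul_eq_mul]
  exact Finset.sum_congr rfl fun i _ => mul_comm _ _

end Dictionary

end CornerEngineCalcV

open CornerEngineCalcV in
/-- **Corner engine, vertical calculus.**  For the hypothesised dictionary `gd` (vertical letter
densities `(c₂ + c₃ ξ)/φ_k(ξ, s)`), `qV` (dilated cubical word integrands
`∏ᵢ [v i = 1 ? 1/yᵢ : (η y₀⋯y_{i-1}) gd (v i) ξ (η y₀⋯yᵢ)]`) and `dqV` (their Leibniz-rule
`η`-derivatives): (1) the factorisation of `qV v (Fin.cons y₀ y') ξ η` at the outermost variable;
(2) `HasDerivAt (qV v y ξ ·) (dqV v y ξ η) η` on the box `[0,1]ⁿ × [0,α] × [0,β]`, where the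
divisors `φ_k`, `k ∉ {0,1}`, do not vanish; (3) the Euler identity
`∂ₜ|_{t=y₀} (t · qV v (cons t y') ξ η) = η · dqV v (cons y₀ y') ξ η` for `y₀ ∈ (0,1)`;
(4) continuity of `t ↦ t · qV v (cons t y') ξ η` on `[0,1]` when the last letter is not `1`
(and the trivial value `0` at `t = 0`).  Elementary real calculus behind the Newton–Leibniz move
of the corner principle. [cite: KontsevichZagier2001, §1.2] -/
theorem cornerEngine_calcV :
    ∀ (m : ℕ) (cf : Fin (m + 2) → Fin 4 → ℚ) (α β : ℚ) (h0 : cf 0 = ![0, 1, 0, 0]) (h1 : cf 1 = ![0, 0, 1, 0]) (hreg : ∀ k : Fin (m + 2), k ≠ 0 → k ≠ 1 → ∀ x y : ℝ, 0 ≤ x → x ≤ (α : ℝ) → 0 ≤ y → y ≤ (β : ℝ) → (cf k 0 : ℝ) + (cf k 1 : ℝ) * x + (cf k 2 : ℝ) * y + (cf k 3 : ℝ) * x * y ≠ 0) (gd : Fin (m + 2) → ℝ → ℝ → ℝ) (hgd : ∀ k x s, gd k x s = ((cf k 2 : ℝ) + (cf k 3 : ℝ) * x) / ((cf k 0 : ℝ)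 + (cf k 1 : ℝ) * x + (cf k 2 : ℝ) * s + (cf k 3 : ℝ) * x * s)) (qV : ∀ {n : ℕ}, (Fin n → Fin (m + 2)) → (Fin n → ℝ) → ℝ → ℝ → ℝ) (hqV : ∀ {n : ℕ} (v : Fin n → Fin (m + 2)) (y : Fin n → ℝ) (ξ η : ℝ), qV v y ξ η = ∏ i, if v i = 1 then 1 / y i else (η * ∏ j ∈ Finset.univ.filter (fun j => j < i), y j) * gd (v i) ξ (η * ∏ j ∈ Finset.univ.filter (fun j => j ≤ i), y j)) (dqV : ∀ {n : ℕ}, (Fin n → Fin (m + 2)) → (Fin n → ℝ) → ℝ → ℝ → ℝ) (hdqV : ∀ {n : ℕ} (v : Fin n → Fin (m + 2)) (y : Fin n → ℝ) (ξ η : ℝ), dqV v y ξ η = ∑ j, (if v j = 1 then 0 else (∏ j' ∈ Finset.univ.filter (fun j' => j' < j), y j') * gd (v j) ξ (η * ∏ j' ∈ Finset.univ.filter (fun j' => j' ≤ j), y j') - (η * ∏ j' ∈ Finset.univ.filter (fun j' => j' < j), y j') * (∏ j' ∈ Finset.univ.filter (fun j' => j' ≤ j), y j') * (gd (v j) ξ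 (η * ∏ j' ∈ Finset.univ.filter (fun j' => j' ≤ j), y j')) ^ 2) * ∏ i ∈ Finset.univ.erase j, if v i = 1 then 1 / y i else (η * ∏ j' ∈ Finset.univ.filter (fun j' => j' < i), y j') * gd (v i) ξ (η * ∏ j' ∈ Finset.univ.filter (fun j' => j' ≤ i), y j')), (∀ {n : ℕ} (v : Fin (n + 1) → Fin (m + 2)) (y₀ : ℝ) (y' : Fin n → ℝ) (ξ η : ℝ), qV v (Fin.cons y₀ y') ξ η = (if v 0 = 1 then 1 / y₀ else η * gd (v 0) ξ (η * y₀)) * qV (Fin.tail v) y' ξ (η * y₀)) ∧ (∀ {n : ℕ} (v : Fin n → Fin (m + 2)) (y : Fin n → ℝ) (ξ η : ℝ), (∀ i, 0 ≤ y i ∧ y i ≤ 1) → 0 ≤ ξ → ξ ≤ (α : ℝ) → 0 ≤ η → η ≤ (β : ℝ) → HasDerivAt (fun s => qV v y ξ s) (dqV v y ξ η) η) ∧ (∀ {n : ℕ} (v : Fin (n + 1) → Fin (m + 2)) (y₀ : ℝ) (y' : Fin n → ℝ) (ξ η : ℝ), 0 < y₀ → y₀ < 1 → (∀ i, 0 ≤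 y' i ∧ y' i ≤ 1) → 0 ≤ ξ → ξ ≤ (α : ℝ) → 0 ≤ η → η ≤ (β : ℝ) → HasDerivAt (fun t => t * qV v (Fin.cons t y') ξ η) (η * dqV v (Fin.cons y₀ y') ξ η) y₀) ∧ (∀ {n : ℕ} (v : Fin (n + 1) → Fin (m + 2)) (y' : Fin n → ℝ) (ξ η : ℝ), v (Fin.last n) ≠ 1 → (∀ i, 0 ≤ y' i ∧ y' i ≤ 1) → 0 ≤ ξ → ξ ≤ (α : ℝ) → 0 ≤ η → η ≤ (β : ℝ) → ContinuousOn (fun t => t * qV v (Fin.cons t y') ξ η) (Set.Icc 0 1) ∧ (0 : ℝ) * qV v (Fin.cons 0 y') ξ η = 0) := by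
  intro m cf α β h0 _h1 hreg gd hgd qV hqV dqV hdqV
  have h01 : 0 ≤ (1 : ℝ) ∧ (1 : ℝ) ≤ 1 := ⟨zero_le_one, le_rfl⟩
  refine ⟨fun v y₀ y' ξ η => qV_cons hqV v y₀ y' ξ η,
    fun v y ξ η hy hξ0 hξα hη0 hηβ => hasDerivAt_qV hgd hqV hdqV h0 hreg v y ξ η hy hξ0 hξα hη0 hηβ,
    ?_, ?_⟩
  · -- (3) Euler identity
    intro n v y₀ y' ξ η hy0 hy1 hy hξ0 hξα hη0 hηβ
    have hηy : 0 ≤ η * y₀ ∧ η * y₀ ≤ β :=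
      ⟨mul_nonneg hη0 hy0.le, (mul_le_of_le_one_right hη0 hy1.le).trans hηβ⟩
    have dA : HasDerivAt (fun s => qV v (Fin.cons y₀ y') ξ s) (dqV v (Fin.cons y₀ y') ξ η) η :=
      hasDerivAt_qV hgd hqV hdqV h0 hreg v _ ξ η (cons_mem ⟨hy0.le, hy1.le⟩ hy) hξ0 hξα hη0 hηβ
    have dB : HasDerivAt (fun s => qV v (Fin.cons 1 y') ξ s)
        (dqV v (Fin.cons 1 y') ξ (η * y₀)) (η * y₀) :=
      hasDerivAt_qV hgd hqV hdqV h0 hreg v _ ξ (η * y₀) (cons_mem h01 hy) hξ0 hξα hηy.1 hηy.2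
    -- scaling in `η`: `qV v (cons y₀ y') ξ s = y₀⁻¹ · qV v (cons 1 y') ξ (s y₀)`
    have hsc : (fun s => qV v (Fin.cons y₀ y') ξ s) =
        fun s => y₀⁻¹ * qV v (Fin.cons 1 y') ξ (s * y₀) := by
      funext s
      rw [← mul_qV_cons hqV v y₀ hy0.ne' y' ξ s, inv_mul_cancel_left₀ hy0.ne']
    have dA' : HasDerivAt (fun s => qV v (Fin.cons y₀ y') ξ s)
        (y₀⁻¹ * (dqV v (Fin.cons 1 y') ξ (η * y₀) * y₀)) η := by
      rw [hsc]
      exact (dB.comp_of_eq η (hasDerivAt_mul_const y₀) rfl).const_mul y₀⁻¹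
    have huniq : dqV v (Fin.cons y₀ y') ξ η = dqV v (Fin.cons 1 y') ξ (η * y₀) := by
      rw [dA.unique dA', mul_comm _ y₀, inv_mul_cancel_left₀ hy0.ne']
    rw [huniq]
    have dC := dB.comp_of_eq y₀ (hasDerivAt_const_mul η) rfl
    refine (dC.congr_of_eventuallyEq ?_).congr_deriv (mul_comm _ _)
    filter_upwards [eventually_ne_nhds hy0.ne'] with t ht
    simp only [Function.comp_apply]
    exact mul_qV_cons hqV v t ht y' ξ η
  · -- (4) continuity on `[0, 1]`
    intro n v y' ξ η hv hy hξ0 hξα hη0 hηβ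
    refine ⟨?_, zero_mul _⟩
    have hfun : (fun t => t * qV v (Fin.cons t y') ξ η) =
        fun t => qV v (Fin.cons 1 y') ξ (η * t) := by
      funext t
      rcases eq_or_ne t 0 with rfl | ht
      · rw [zero_mul, mul_zero, qV_zero hqV v (Fin.cons 1 y') ξ (Fin.last n) hv]
      · exact mul_qV_cons hqV v t ht y' ξ η
    rw [hfun]
    intro t ht
    have hηt : 0 ≤ η * t ∧ η * t ≤ β :=
      ⟨mul_nonneg hη0 ht.1, (mul_le_of_le_one_right hη0 ht.2).trans hηβ⟩
    have dB : HasDerivAt (fun s => qV v (Fin.cons 1 y') ξ s)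
        (dqV v (Fin.cons 1 y') ξ (η * t)) (η * t) :=
      hasDerivAt_qV hgd hqV hdqV h0 hreg v _ ξ (η * t) (cons_mem h01 hy) hξ0 hξα hηt.1 hηt.2
    exact (dB.comp_of_eq t (hasDerivAt_const_mul η) rfl).continuousAt.continuousWithinAt

end Summit.KontsevichZagierPeriods.FurushoPentagon.PentagonInKZ
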